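import Mathlib
import Summits.ValiantsHypothesis.ValiantsHypothesis.Theorems.DivisionGapPerCofactorDegreeReductionStubProbeRichRung
import Summits.ValiantsHypothesis.ValiantsHypothesis.Theorems.DivisionGapPerCofactorDegreeReductionStubWindowOfRung

/-!
# `DivisionGap.PerCofactorDegreeReduction` (stmt-ValiantsHypothesis-15046), line `Sketch_ideator4`:
probe-rich classes in the window currency (stub `stub_probeRichWindow`, T)

Rung P (`ProbeRichRung.stub_probeRichRung`) shows that a probe-rich cofactor `h` (a `Z`-probe
near every permutation, for a fixed set `Z` of `k` row shifts containing `1`, `3k ≤ n`) forces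
`n! · 3^q ≤ L · 2^q · n!` with `q := ⌊n/(3k²)⌋` and `L := L⁺(per_n · h)`.  This file converts
that rung into the window currency `n ≤ (log₂ n + log₂ L + c)^c` consumed by the core stub,
once and for all `k ≥ 1`, with the explicit witnesses `c := 6k²`, `n₀ := 3k`.

Proof.  Cancel `n! > 0`: `3^q ≤ L · 2^q`.  Since `8^q ≤ 9^q`, i.e. `(2^q)^3 ≤ (3^q)^2 ≤ L² (2^q)^2`,
cancelling `(2^q)^2` gives `2^q ≤ L²`.  With `S := log₂ L` we have `L < 2^(S+1)`, so
`2^q ≤ L² < 2^(2S+2)` and `q ≤ 2S + 1`.  Hence `n < 3k² (q + 1) ≤ 3k² (2S + 2) = 6k² S + 6k²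
≤ (S + 6k²)² ≤ (log₂ n + S + 6k²)^(6k²)`. [folklore]
-/

noncomputable section

-- `Summit.ValiantsHypothesis.ValiantsHypothesis.…` is the tree's mandated single-conjunct layout
-- (Sub = Summit), so the duplicated namespace component is intended.
set_option linter.dupNamespace false

open MvPolynomial Literature.Computability.AlgebraicComplexity
open scoped NNReal

namespace Summit.ValiantsHypothesis.ValiantsHypothesis.Theorems.DivisionGap.PerCofactorDegreeReduction.ProbeRichWindow

/-- `8^q ≤ 9^q` in use: if `3^q ≤ L · 2^q` then `2^q ≤ L²`
(`(2^q)^3 ≤ (3^q)^2 ≤ L² · (2^q)^2`, cancel `(2^q)^2`). [folklore] -/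
theorem two_pow_le_sq_of_three_pow_le (q L : ℕ) (h : 3 ^ q ≤ L * 2 ^ q) : 2 ^ q ≤ L ^ 2 := by
  have h89 : (2 ^ q) ^ 3 ≤ (3 ^ q) ^ 2 :=
    calc (2 ^ q) ^ 3 = (2 ^ 3) ^ q := by rw [← pow_mul, ← pow_mul, mul_comm]
      _ ≤ (3 ^ 2) ^ q := Nat.pow_le_pow_left (by norm_num) q
      _ = (3 ^ q) ^ 2 := by rw [← pow_mul, ← pow_mul, mul_comm]
  have hkey : 2 ^ q * (2 ^ q) ^ 2 ≤ L ^ 2 * (2 ^ q) ^ 2 :=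
    calc 2 ^ q * (2 ^ q) ^ 2 = (2 ^ q) ^ 3 := (pow_succ' (2 ^ q) 2).symm
      _ ≤ (3 ^ q) ^ 2 := h89
      _ ≤ (L * 2 ^ q) ^ 2 := Nat.pow_le_pow_left h 2
      _ = L ^ 2 * (2 ^ q) ^ 2 := mul_pow L (2 ^ q) 2
  exact Nat.le_of_mul_le_mul_right hkey (by positivity)

/-- If `2^q ≤ L²` then `q < 2 log₂ L + 2` (from `L < 2^(log₂ L + 1)` squared). [folklore] -/
theorem lt_two_mul_log_add_two (q L : ℕ) (h : 2 ^ q ≤ L ^ 2) : q < 2 * Nat.log 2 L + 2 := by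
  have hL : L < 2 ^ (Nat.log 2 L + 1) := Nat.lt_pow_succ_log_self one_lt_two L
  have hL2 : L ^ 2 < (2 ^ (Nat.log 2 L + 1)) ^ 2 := Nat.pow_lt_pow_left hL two_ne_zero
  rw [← pow_mul] at hL2
  have hq : q < (Nat.log 2 L + 1) * 2 :=
    (Nat.pow_lt_pow_iff_right (by norm_num)).mp (lt_of_le_of_lt h hL2)
  omega

/-- Arithmetic core of the window conversion: for `1 ≤ k`, `3^⌊n/(3k²)⌋ ≤ L · 2^⌊n/(3k²)⌋` forces
`n ≤ (log₂ n + log₂ L + 6k²)^(6k²)`. [folklore] -/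
theorem window_of_three_pow_le (n k L : ℕ) (hk : 1 ≤ k)
    (h : 3 ^ (n / (3 * k ^ 2)) ≤ L * 2 ^ (n / (3 * k ^ 2))) :
    n ≤ (Nat.log 2 n + Nat.log 2 L + 6 * k ^ 2) ^ (6 * k ^ 2) := by
  have hK : 1 ≤ k ^ 2 := Nat.one_le_pow 2 k hk
  have hq : n / (3 * k ^ 2) < 2 * Nat.log 2 L + 2 :=
    lt_two_mul_log_add_two _ _ (two_pow_le_sq_of_three_pow_le _ _ h)
  have hn : n < 3 * k ^ 2 * (2 * Nat.log 2 L + 2) :=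
    calc n < 3 * k ^ 2 * (n / (3 * k ^ 2) + 1) := Nat.lt_mul_div_succ n (by omega)
      _ ≤ 3 * k ^ 2 * (2 * Nat.log 2 L + 2) := Nat.mul_le_mul_left _ hq
  calc n ≤ (Nat.log 2 L + 6 * k ^ 2) ^ 2 := by
        nlinarith [hn, hK, Nat.zero_le (Nat.log 2 L)]
    _ ≤ (Nat.log 2 n + Nat.log 2 L + 6 * k ^ 2) ^ 2 := Nat.pow_le_pow_left (by omega) 2
    _ ≤ (Nat.log 2 n + Nat.log 2 L + 6 * k ^ 2) ^ (6 * k ^ 2) :=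
        Nat.pow_le_pow_right (by omega) (by omega)

/-- **Stub T (probe-rich classes in the window currency) of line `Sketch_ideator4`.**  For every
`k ≥ 1` there are `c, n₀` (namely `c := 6k²`, `n₀ := 3k`) such that for all `n ≥ n₀`, every set
`Z` of `k` row shifts containing `1` and every torus-homogeneous cofactor `h ∈ ℝ≥0[x_ij]` with a
`Z`-probe near every permutation, the monotone complexity `L := L⁺(per_n · h)` satisfies the
window bound `n ≤ (log₂ n + log₂ L + c)^c`: rung P gives `n! · 3^q ≤ L · 2^q · n!`,
`q = ⌊n/(3k²)⌋`, and `window_of_three_pow_le` converts. [folklore] -/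
theorem stub_probeRichWindow :
    ∀ k : ℕ, 1 ≤ k → ∃ c n₀ : ℕ, ∀ n ≥ n₀, ∀ (Z : Finset (Equiv.Perm (Fin n))), Z.card = k →
      (1 : Equiv.Perm (Fin n)) ∈ Z →
      ∀ h : MvPolynomial (Fin n × Fin n) ℝ≥0,
        (∃ τ : (Fin n →₀ ℕ) × (Fin n →₀ ℕ),
          ∀ m ∈ h.support, (Finsupp.mapDomain Prod.fst m, Finsupp.mapDomain Prod.snd m) = τ) →
        (∀ π : Equiv.Perm (Fin n), ∃ m ∈ h.support, ∀ e ∈ m.support, ∃ ζ ∈ Z, π e.2 = ζ e.1) →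
        n ≤ (Nat.log 2 n + Nat.log 2 (complexity (perPoly (Fin n) ℝ≥0 * h)) + c) ^ c := by
  intro k hk
  refine ⟨6 * k ^ 2, 3 * k, fun n hn Z hZ h1Z h hτ hprobe => ?_⟩
  have hrung := ProbeRichRung.stub_probeRichRung n k Z hZ hk hn h1Z h hτ hprobe
  refine window_of_three_pow_le n k _ hk (Nat.le_of_mul_le_mul_left ?_ (Nat.factorial_pos n))
  calc Nat.factorial n * 3 ^ (n / (3 * k ^ 2))
      ≤ complexity (perPoly (Fin n) ℝ≥0 * h) * (2 ^ (n / (3 * k ^ 2)) * Nat.factorial n) := hrung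
    _ = Nat.factorial n * (complexity (perPoly (Fin n) ℝ≥0 * h) * 2 ^ (n / (3 * k ^ 2))) := by
        ring

end Summit.ValiantsHypothesis.ValiantsHypothesis.Theorems.DivisionGap.PerCofactorDegreeReduction.ProbeRichWindow

end
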